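import Summits.Langlands.Langlands.Theses.DyadicOddResidue
import Literature.NumberTheory.Automorphic.GLnAdelicStructureProofs
import Literature.FieldTheory.AlgClosed.PadicAlgClEquivComplex

/-!
# `DyadicEisensteinFM` (stmt-Langlands-18741) — negative knowledge II: the conclusion re-implies
# the hypothesis "unramified almost everywhere", unconditionally; the a.e. form is tight

Support lemmas of the standing disprover (`Cruxes/DyadicEisensteinFM/Disproof.lean`, cycle 1,
§3–§4; refuter-cdisprove-stmt-Langlands-18741-0, 2026-08-17), on the hypothesis
`∀ᶠ v in cofinite, ρ.IsUnramifiedAt v` and on the shape of the conclusion of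
`Summit.Langlands.Langlands.Theses.DyadicOddResidue.DyadicEisensteinFM`.

* `eventually_isUnramifiedAt_of_conclusion` — the conclusion of the crux (for ALL level witnesses
  `hcpt` and ALL `ι : ℚ̄₂ ≃+* ℂ`, an L-algebraic cuspidal `π` Satake–Frobenius compatible with `ρ`
  at cofinitely many places) implies that `ρ` is unramified at all but finitely many places, with
  NO extra input: the Satake clause `SatakeFrobCompatibleAt` is conjunctive, and both universal
  binders are instantiable in the tree (`isCompact_glFiniteIntegralLevel_holds 2 ℚ`, PROVED;
  `PadicAlgCl.nonempty_ringEquiv_complex 2`, Steinitz).  Hence dropping the hypothesis "unramified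
  a.e." from the crux turns it into the crux PLUS the assertion that every continuous irreducible
  odd de Rham-regular residually reducible `ρ : Γ_ℚ → GL₂(ℚ̄₂)` is a.e. unramified — false in
  nature (infinitely ramified representations: Ramakrishna, Ann. of Math. 151 (2000);
  Khare–Larsen–Ramakrishna, Amer. J. Math. 127 (2005)); the hypothesis is load-bearing.
* `not_satakeFrobCompatibleAt_of_not_isUnramifiedAt` — `SatakeFrobCompatibleAt … ρ v` fails at
  every place where `ρ` ramifies, so the `∀ᶠ v` of the conclusion cannot be upgraded to `∀ v` for
  any `ρ` ramified somewhere (e.g. `ρ_{f,2}`, `f` = 11a, at `11`): the almost-everywhere form is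
  tight on the modular locus itself.

Nothing here asserts a route statement. [folklore]
-/

set_option linter.dupNamespace false -- project-wide option; `Summit.Langlands.Langlands` is the mandated namespace

noncomputable section

open NumberField IsDedekindDomain Filter
open Literature.NumberTheory.GaloisRepresentations Literature.NumberTheory.Automorphic
open Summit.Langlands

namespace Summit.Langlands.Langlands.Theorems.DyadicEisensteinFM.Negative

/-- **The conclusion of `DyadicEisensteinFM` forces "unramified almost everywhere"**,
unconditionally (instantiate `hcpt` by the proved level fact and `ι` by Steinitz, then read the
conjunct `ρ.IsUnramifiedAt v` of `SatakeFrobCompatibleAt` at cofinitely many `v`). [folklore] -/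
theorem eventually_isUnramifiedAt_of_conclusion (ρ : FramedGaloisRep ℚ (PadicAlgCl 2) 2)
    (h : ∀ (hcpt : isCompact_glFiniteIntegralLevel 2 ℚ) (ι : PadicAlgCl 2 ≃+* ℂ),
      ∃ π : CuspidalAutomorphicRepData 2 ℚ hcpt, π.1.IsLAlgebraic ∧
        ∀ᶠ v : HeightOneSpectrum (𝓞 ℚ) in cofinite, SatakeFrobCompatibleAt ι π.1 ρ v) :
    ∀ᶠ v : HeightOneSpectrum (𝓞 ℚ) in cofinite, ρ.IsUnramifiedAt v := by
  obtain ⟨ι⟩ := PadicAlgCl.nonempty_ringEquiv_complex 2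
  obtain ⟨π, -, hπ⟩ := h (isCompact_glFiniteIntegralLevel_holds 2 ℚ) ι
  exact hπ.mono fun v ⟨_, _, hρ, _⟩ => hρ

/-- **The almost-everywhere form of the conclusion is tight**: `SatakeFrobCompatibleAt ι π ρ v`
contains the conjunct `ρ.IsUnramifiedAt v`, so it fails at every ramified place of `ρ`.
[folklore] -/
theorem not_satakeFrobCompatibleAt_of_not_isUnramifiedAt
    {hcpt : isCompact_glFiniteIntegralLevel 2 ℚ} (ι : PadicAlgCl 2 ≃+* ℂ)
    (π : CuspidalAutomorphicRepData 2 ℚ hcpt) {ρ : FramedGaloisRep ℚ (PadicAlgCl 2) 2}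
    {v : HeightOneSpectrum (𝓞 ℚ)} (hv : ¬ ρ.IsUnramifiedAt v) :
    ¬ SatakeFrobCompatibleAt ι π.1 ρ v :=
  fun ⟨_, _, hρ, _⟩ => hv hρ

/-- **Corollary: an automorphic `ρ` ramified at `v` has `v` in the exceptional set** — for every
witness `π` of the conclusion, the cofinite set of compatible places excludes all ramified places
of `ρ`. [folklore] -/
theorem exceptional_of_ramified {hcpt : isCompact_glFiniteIntegralLevel 2 ℚ} (ι : PadicAlgCl 2 ≃+* ℂ)
    (π : CuspidalAutomorphicRepData 2 ℚ hcpt) {ρ : FramedGaloisRep ℚ (PadicAlgCl 2) 2}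
    {v : HeightOneSpectrum (𝓞 ℚ)} (hv : ¬ ρ.IsUnramifiedAt v) :
    v ∈ {w | ¬ SatakeFrobCompatibleAt ι π.1 ρ w} :=
  not_satakeFrobCompatibleAt_of_not_isUnramifiedAt ι π hv

end Summit.Langlands.Langlands.Theorems.DyadicEisensteinFM.Negative

end
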